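import Summits.Schanuel.Schanuel.Theorems.RootDecomp1JRankKernel
import Summits.Schanuel.Schanuel.Theses.RootDecomp1J

/-!
# Dominance: what the lower binders of route `RootDecomp1J` prove (supports `stmt-Schanuel-30523`)

`route-Schanuel-RootDecomp1J` rev 3: `closes : A → P3 → P5 → T → Λ → K₁ → K₂ → Schanuel`, K₂ split as
`G₂ ∧ K₃` (glue 30524 closed).  This file records, UNCONDITIONALLY, what the binders below the residual
K₃ = `SchanuelOverPairClosedFields` (stmt-Schanuel-30523) already decide:

* `schanuelOn_curveHull_of_binders` : `A → P3 → P5 → T → Λ → K₁ → S|𝓚` and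
  `schanuelOn_pairHull_of_binders` : `… → G₂ → S|𝓚₂` (the E2 chain of `Theses/RootDecomp1J.closes`, via the
  landed engine `RootDecomp1DFlagSplit.schanuelOn_of_relOn`, over the items' literal spaces);
* **E2 at bounded free rank** (`schanuelOn_finrank_of_relOnRank`): `S|E` + every `Rel(E'|E)` instance of
  rank `≤ M` ⟹ Schanuel's count for every free `x̄ ⊂ E'` with `|x̄| ≤ dim_ℚ(span x̄ ∩ E) + M`;
* hence, with the rank kernel (`RootDecomp1JRankKernel`): **the seven lower binders prove Schanuel's
  conjecture for every `n ≤ 3`** (`schanuelUpTo_three_of_binders`) and confine every counterexample at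
  **clearance `4` from `𝓚₂`** (`clearance_four_of_binders`: `dim_ℚ(span x̄ ∩ 𝓚₂) + 4 ≤ |x̄|`); **the six
  lower binders prove `SchanuelTwo`** = stmt-Schanuel-0069, the `n = 2` item shared by routes `RootDecomp1`,
  `EclCore`, `RoyCriterion` (`schanuelTwo_of_binders`, stated over that item's literal text); and under the
  seven binders every `ℚ`-free exp-`3`-cycle is algebraically free (`threeCycle_of_binders`).

Compare `Theorems/RootDecomp1HBlockClearance` (lens 5, gen 7), whose clearance theorems assume an absolute
block-absorption certificate `AbsorbsBlocks 2 K`: here the certificate is the gap lemma, i.e. nothing beyond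
`𝓚₂^{B≤2} ≤ 𝓚₂`.

Provenance: decomposition cell `decomp-schanuel`, lens 3, NODE v10 §33.4 (kernel-checked there); ported with
the sector predicates written out. Nothing here proves Schanuel; the route stays DRAFT.
-/

set_option linter.dupNamespace false

noncomputable section

open Complex IntermediateField
open Literature.Barriers.Schanuel (trdeg_mono)
open Summit.Schanuel.Schanuel.Theorems.RootDecomp1DFlagSplit (trdeg_adjoin_union_eq_add
  trdeg_adjoin_le_cardinalMk trdeg_gens_lt_aleph0 rel_iff_add disjoint_span_of_linearIndependent_mkQ
  schanuelOn_of_relOn)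
open Summit.Schanuel.Schanuel.Theorems.RootDecomp1JKhovanskiiBlocks (mem_and_isAlgebraic_exp_of_mem_span
  mem_and_isAlgebraic_exp_of_mem_span_set reltrdeg_le_of_isAlgebraic trdeg_witnessField_lt_aleph0)
open Summit.Schanuel.Schanuel.Theorems.RootDecomp1JBlockHulls
open Summit.Schanuel.Schanuel.Theorems.RootDecomp1JGapLemma
open Summit.Schanuel.Schanuel.Theorems.RootDecomp1JRankKernel
open Summit.Schanuel.Schanuel.Theses.RootDecomp1J

namespace Summit.Schanuel.Schanuel.Theorems.RootDecomp1JBinderKernel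

/-! ### §1 E2 at bounded free rank -/

open Submodule in
/-- **(E2 at bounded FREE rank — the clearance form.)** `S|E →` (every `Rel(E'|E)` instance of rank
`≤ M`) `→` Schanuel's count for every `ℚ`-free tuple `x̄` of `E'` with `|x̄| ≤ dim_ℚ(span x̄ ∩ E) + M`
(split `span x̄ = (span x̄ ∩ E) ⊕ U`, clear denominators, count inside by `S|E`, count `U` — of rank
`|x̄| - dim(span x̄ ∩ E) ≤ M` — relatively, tower law). -/
theorem schanuelOn_finrank_of_relOnRank {E E' : Submodule ℚ ℂ}
    (hA : (∀ (k : ℕ) (y : Fin k → ℂ), (∀ i, y i ∈ (E)) → LinearIndependent ℚ y →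
      (k : Cardinal) ≤ Algebra.trdeg ℚ ↥(adjoin ℚ (Set.range y ∪ Set.range (cexp ∘ y))))) {M : ℕ}
    (hB : RelOnRank E E' M) : ∀ (n : ℕ) (x : Fin n → ℂ),
      n ≤ Module.finrank ℚ ↥(span ℚ (Set.range x) ⊓ E) + M → (∀ i, x i ∈ E') →
      LinearIndependent ℚ x →
      (n : Cardinal) ≤ Algebra.trdeg ℚ ↥(adjoin ℚ (Set.range x ∪ Set.range (cexp ∘ x))) := by
  intro n x hnM hxE' hx
  set V : Submodule ℚ ℂ := span ℚ (Set.range x) with hV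
  haveI : FiniteDimensional ℚ V := FiniteDimensional.span_of_finite ℚ (Set.finite_range x)
  have hVE' : V ≤ E' := span_le.mpr (Set.range_subset_iff.mpr hxE')
  set W : Submodule ℚ ℂ := V ⊓ E with hW
  obtain ⟨U', hU'⟩ := W.exists_isCompl
  set U : Submodule ℚ ℂ := V ⊓ U' with hU
  haveI : FiniteDimensional ℚ W := Submodule.finiteDimensional_of_le inf_le_left
  haveI : FiniteDimensional ℚ U := Submodule.finiteDimensional_of_le inf_le_left
  have hWU_sup : W ⊔ U = V := by
    rw [hU, inf_comm, ← sup_inf_assoc_of_le U' (inf_le_left : W ≤ V), hU'.sup_eq_top, top_inf_eq]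
  have hWU_disj : Disjoint W U := hU'.disjoint.mono_right inf_le_right
  have hUE_disj : Disjoint U E := by
    rw [disjoint_def]
    intro a haU haE
    exact (disjoint_def.mp hWU_disj) a ⟨inf_le_left (b := U') haU, haE⟩ haU
  -- dimensions
  set k := Module.finrank ℚ W
  set m := Module.finrank ℚ U
  have hn : k + m = n := by
    have h1 := Submodule.finrank_sup_add_finrank_inf_eq W U
    rw [hWU_disj.eq_bot, finrank_bot, add_zero, hWU_sup] at h1
    rw [← h1, hV, finrank_span_eq_card hx, Fintype.card_fin]
  -- bases
  let bW := Module.finBasis ℚ W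
  let bU := Module.finBasis ℚ U
  let y : Fin k → ℂ := fun i => (bW i : ℂ)
  let z : Fin m → ℂ := fun j => (bU j : ℂ)
  have hy_mem : ∀ i, y i ∈ E := fun i => ((bW i).2 : (bW i : ℂ) ∈ V ⊓ E).2
  have hy_V : ∀ i, y i ∈ V := fun i => ((bW i).2 : (bW i : ℂ) ∈ V ⊓ E).1
  have hz_U : ∀ j, z j ∈ U := fun j => (bU j).2
  have hz_V : ∀ j, z j ∈ V := fun j => inf_le_left (b := U') (hz_U j)
  have hy_li : LinearIndependent ℚ y := bW.linearIndependent.map' W.subtype W.ker_subtype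
  have hz_li : LinearIndependent ℚ z := bU.linearIndependent.map' U.subtype U.ker_subtype
  -- clearing denominators
  choose Ny hNy hNy_mem using fun i =>
    Literature.NumberTheory.Transcendental.exists_nsmul_mem_span_int x (hy_V i)
  choose Nz hNz hNz_mem using fun j =>
    Literature.NumberTheory.Transcendental.exists_nsmul_mem_span_int x (hz_V j)
  let cy : Fin k → ℚˣ := fun i => Units.mk0 (Ny i : ℚ) (Nat.cast_ne_zero.mpr (hNy i))
  let cz : Fin m → ℚˣ := fun j => Units.mk0 (Nz j : ℚ) (Nat.cast_ne_zero.mpr (hNz j))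
  let y' : Fin k → ℂ := fun i => (Ny i : ℚ) • y i
  let z' : Fin m → ℂ := fun j => (Nz j : ℚ) • z j
  have hy'_eq : cy • y = y' := by
    funext i; simp only [Pi.smul_apply', cy, y', Units.smul_def, Units.val_mk0]
  have hz'_eq : cz • z = z' := by
    funext j; simp only [Pi.smul_apply', cz, z', Units.smul_def, Units.val_mk0]
  have hy'_li : LinearIndependent ℚ y' := hy'_eq ▸ hy_li.units_smul cy
  have hz'_li : LinearIndependent ℚ z' := hz'_eq ▸ hz_li.units_smul cz
  have hy'_mem : ∀ i, y' i ∈ E := fun i => E.smul_mem _ (hy_mem i)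
  have hz'_U : ∀ j, z' j ∈ U := fun j => U.smul_mem _ (hz_U j)
  have hz'_E' : ∀ j, z' j ∈ E' := fun j => hVE' (V.smul_mem _ (hz_V j))
  have hz'_modE : LinearIndependent ℚ (E.mkQ ∘ z') := by
    refine hz'_li.map ?_
    rw [ker_mkQ]
    exact hUE_disj.mono_left (span_le.mpr (Set.range_subset_iff.mpr hz'_U))
  -- the field-theoretic estimate
  set Sz := Set.range z' ∪ Set.range (cexp ∘ z') with hSz
  set Sy := Set.range y' ∪ Set.range (cexp ∘ y') with hSy
  set Ky := adjoin ℚ Sy with hKy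
  have hk : (k : Cardinal) ≤ Algebra.trdeg ℚ Ky := hA k y' hy'_mem hy'_li
  have hm : (m : Cardinal) ≤ Algebra.trdeg Ky (adjoin Ky Sz) := hB k m y' z' (by omega) hy'_mem hz'_E' hz'_modE
  have hkm : (k : Cardinal) + m ≤ Algebra.trdeg ℚ (adjoin ℚ (Sy ∪ Sz)) :=
    Literature.NumberTheory.Transcendental.add_le_trdeg_adjoin_union Sy Sz hk hm
  -- comparison with `ℚ(x̄, e^{x̄})`
  set Kx := adjoin ℚ (Set.range x ∪ Set.range (cexp ∘ x)) with hKx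
  have hle : adjoin ℚ (Sy ∪ Sz) ≤ Kx := by
    rw [adjoin_le_iff]
    rintro a ((⟨i, rfl⟩ | ⟨i, rfl⟩) | (⟨j, rfl⟩ | ⟨j, rfl⟩))
    · exact (Literature.NumberTheory.Transcendental.mem_adjoin_of_mem_span_int x (hNy_mem i)).1
    · exact (Literature.NumberTheory.Transcendental.mem_adjoin_of_mem_span_int x (hNy_mem i)).2
    · exact (Literature.NumberTheory.Transcendental.mem_adjoin_of_mem_span_int x (hNz_mem j)).1
    · exact (Literature.NumberTheory.Transcendental.mem_adjoin_of_mem_span_int x (hNz_mem j)).2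
  calc (n : Cardinal) = (k : Cardinal) + m := by rw [← hn, Nat.cast_add]
    _ ≤ Algebra.trdeg ℚ (adjoin ℚ (Sy ∪ Sz)) := hkm
    _ ≤ Algebra.trdeg ℚ Kx := trdeg_mono hle

/-- **(E2 at bounded rank.)** `S|E →` (every `Rel(E'|E)` instance of rank `≤ M`) `→` Schanuel's count
for every `ℚ`-free tuple of `E'` of length `≤ M`. -/
theorem schanuelOn_rank_of_relOnRank {E E' : Submodule ℚ ℂ} 
    (hA : (∀ (k : ℕ) (y : Fin k → ℂ), (∀ i, y i ∈ (E)) → LinearIndependent ℚ y →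
      (k : Cardinal) ≤ Algebra.trdeg ℚ ↥(adjoin ℚ (Set.range y ∪ Set.range (cexp ∘ y))))) {M : ℕ}
    (hB : RelOnRank E E' M) : ∀ (n : ℕ) (x : Fin n → ℂ), n ≤ M → (∀ i, x i ∈ E') →
      LinearIndependent ℚ x →
      (n : Cardinal) ≤ Algebra.trdeg ℚ ↥(adjoin ℚ (Set.range x ∪ Set.range (cexp ∘ x))) :=
  fun n x hnM hxE' hx => schanuelOn_finrank_of_relOnRank hA hB n x (hnM.trans (Nat.le_add_left _ _))
    hxE' hx

/-- **DOMINANCE.** `S|E` for an `N`-block-closed `E` (`N ≥ 1`) gives Schanuel's conjecture for ALL `ℚ`-free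
tuples of length `≤ N + 1`. -/
theorem schanuelUpTo_of_schanuelOn_blockClosed {N : ℕ} (hN : 1 ≤ N) {E : Submodule ℚ ℂ}
    (hE : blockStep N E ≤ E)
    (hS : (∀ (k : ℕ) (y : Fin k → ℂ), (∀ i, y i ∈ (E)) → LinearIndependent ℚ y →
      (k : Cardinal) ≤ Algebra.trdeg ℚ ↥(adjoin ℚ (Set.range y ∪ Set.range (cexp ∘ y))))) :
    ∀ (n : ℕ) (x : Fin n → ℂ), n ≤ N + 1 → LinearIndependent ℚ x →
      (n : Cardinal) ≤ Algebra.trdeg ℚ ↥(adjoin ℚ (Set.range x ∪ Set.range (cexp ∘ x))) :=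
  fun n x hn hx => schanuelOn_rank_of_relOnRank hS (relOnRank_of_blockClosed hN hE ⊤) n x hn
    (fun _ => Submodule.mem_top) hx

/-- **CLEARANCE `N + 2`.** `S|E` for an `N`-block-closed `E` (`N ≥ 1`): every counterexample `x̄` to
Schanuel's conjecture (`ℚ`-free, `trdeg ℚ(x̄, e^{x̄}) < |x̄|`) satisfies `dim_ℚ(span x̄ ∩ E) + N + 2 ≤ |x̄|`. -/
theorem clearance_of_schanuelOn_blockClosed {N : ℕ} (hN : 1 ≤ N) {E : Submodule ℚ ℂ}
    (hE : blockStep N E ≤ E)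
    (hS : (∀ (k : ℕ) (y : Fin k → ℂ), (∀ i, y i ∈ (E)) → LinearIndependent ℚ y →
      (k : Cardinal) ≤ Algebra.trdeg ℚ ↥(adjoin ℚ (Set.range y ∪ Set.range (cexp ∘ y)))))
    {n : ℕ} {x : Fin n → ℂ} (hx : LinearIndependent ℚ x)
    (hdef : Algebra.trdeg ℚ ↥(adjoin ℚ (Set.range x ∪ Set.range (cexp ∘ x))) < (n : Cardinal)) :
    Module.finrank ℚ ↥(Submodule.span ℚ (Set.range x) ⊓ E) + (N + 2) ≤ n := by
  by_contra h
  have hle : n ≤ Module.finrank ℚ ↥(Submodule.span ℚ (Set.range x) ⊓ E) + (N + 1) := by omega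
  exact absurd (schanuelOn_finrank_of_relOnRank hS (relOnRank_of_blockClosed hN hE ⊤) n x hle
    (fun _ => Submodule.mem_top) hx) (not_le.2 hdef)

/-! ### §2 The binder chains of route 1J (E2 along the flag, literal spaces) -/

/-- `A → P3 → P5 → T → Λ → K₁ → S|𝓚` (`𝓚` = the curve hull of the EL-span, the base of K₂ / G₂, literally). -/
theorem schanuelOn_curveHull_of_binders (hA : SchanuelAtBakerPeriods) (h3 : InhomBakerOverBakerFields)
    (h5 : SecondExpOverInhomBakerFields) (hT : IteratedExpOverSecondExpFields)
    (hL : ExpLogOverExpTowerFields) (hK1 : CurvePointsOverExpLogFields) :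
    (∀ (k : ℕ) (y : Fin k → ℂ), (∀ i, y i ∈ (⨆ n : ℕ, (fun E : Submodule ℚ ℂ => E ⊔ Submodule.span ℚ {g : ℂ | ∃ Y : Finset ℂ, (↑Y : Set ℂ) ⊆ ↑E ∧ Algebra.trdeg ↥(IntermediateField.adjoin ℚ ((↑Y : Set ℂ) ∪ Complex.exp '' ↑Y)) ↥(IntermediateField.adjoin ↥(IntermediateField.adjoin ℚ ((↑Y : Set ℂ) ∪ Complex.exp '' ↑Y)) ({g, Complex.exp g} : Set ℂ)) ≤ 1})^[n + 1] (⨆ n : ℕ, (fun E : Submodule ℚ ℂ => (E ⊔ Submodule.span ℚ (Complex.exp '' ↑E)) ⊔ Submodule.span ℚ (Complex.exp ⁻¹' ↑(E ⊔ Submodule.span ℚ (Complex.exp '' ↑E))))^[n + 1] (Submodule.span ℚ ({z : ℂ | IsAlgebraic ℚ z} ∪ {z : ℂ | ∃ β l : ℂ, IsAlgebraic ℚ β ∧ IsAlgebraic ℚ (Complex.exp l) ∧ z = β * l}))))) → LinearIndependent ℚ y →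
      (k : Cardinal) ≤ Algebra.trdeg ℚ ↥(adjoin ℚ (Set.range y ∪ Set.range (cexp ∘ y)))) :=
  have s3 := schanuelOn_of_relOn hA h3
  have s5 := schanuelOn_of_relOn s3 h5
  have sT := schanuelOn_of_relOn s5 hT
  have sL := schanuelOn_of_relOn sT hL
  schanuelOn_of_relOn sL hK1

/-- `… → G₂ → S|𝓚₂` (`𝓚₂` = the pair hull, the base of K₃, literally). -/
theorem schanuelOn_pairHull_of_binders (hA : SchanuelAtBakerPeriods) (h3 : InhomBakerOverBakerFields)
    (h5 : SecondExpOverInhomBakerFields) (hT : IteratedExpOverSecondExpFields)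
    (hL : ExpLogOverExpTowerFields) (hK1 : CurvePointsOverExpLogFields)
    (hG2 : PairBlocksOverCurveClosedFields) :
    (∀ (k : ℕ) (y : Fin k → ℂ), (∀ i, y i ∈ (⨆ n : ℕ, (fun E : Submodule ℚ ℂ => E ⊔ Submodule.span ℚ {x : ℂ | ∃ N : ℕ, N ≤ 2 ∧ ∃ w : Fin N → ℂ, (∃ Y : Finset ℂ, (↑Y : Set ℂ) ⊆ ↑E ∧ ∀ T : Finset ℂ, Y ⊆ T → ∀ (r : ℕ) (ρ : Fin r → Fin N), (∀ j, w j ∈ Submodule.span ℚ ((↑T : Set ℂ) ∪ Set.range (w ∘ ρ))) → Algebra.trdeg ↥(IntermediateField.adjoin ℚ ((↑T : Set ℂ) ∪ Complex.exp '' ↑T)) ↥(IntermediateField.adjoin ↥(IntermediateField.adjoin ℚ ((↑T : Set ℂ) ∪ Complex.exp '' ↑T)) (Set.range w ∪ Set.range (Complex.exp ∘ w))) ≤ r) ∧ x ∈ Set.range w})^[n + 1] (⨆ n : ℕ, (fun E : Submodule ℚ ℂ => E ⊔ Submodule.span ℚ {g : ℂ | ∃ Y : Finset ℂ, (↑Y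 : Set ℂ) ⊆ ↑E ∧ Algebra.trdeg ↥(IntermediateField.adjoin ℚ ((↑Y : Set ℂ) ∪ Complex.exp '' ↑Y)) ↥(IntermediateField.adjoin ↥(IntermediateField.adjoin ℚ ((↑Y : Set ℂ) ∪ Complex.exp '' ↑Y)) ({g, Complex.exp g} : Set ℂ)) ≤ 1})^[n + 1] (⨆ n : ℕ, (fun E : Submodule ℚ ℂ => (E ⊔ Submodule.span ℚ (Complex.exp '' ↑E)) ⊔ Submodule.span ℚ (Complex.exp ⁻¹' ↑(E ⊔ Submodule.span ℚ (Complex.exp '' ↑E))))^[n + 1] (Submodule.span ℚ ({z : ℂ | IsAlgebraic ℚ z} ∪ {z : ℂ | ∃ β l : ℂ, IsAlgebraic ℚ β ∧ IsAlgebraic ℚ (Complex.exp l) ∧ z = β * l})))))) → LinearIndependent ℚ y →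
      (k : Cardinal) ≤ Algebra.trdeg ℚ ↥(adjoin ℚ (Set.range y ∪ Set.range (cexp ∘ y)))) :=
  schanuelOn_of_relOn (schanuelOn_curveHull_of_binders hA h3 h5 hT hL hK1) hG2

/-! ### §3 What the lower binders prove -/

/-- **THE SEVEN LOWER BINDERS OF ROUTE 1J PROVE SCHANUEL'S CONJECTURE FOR EVERY `n ≤ 3`:**
`A → P3 → P5 → T → Λ → K₁ → G₂ → SC_{≤3}`. -/
theorem schanuelUpTo_three_of_binders (hA : SchanuelAtBakerPeriods) (h3 : InhomBakerOverBakerFields)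
    (h5 : SecondExpOverInhomBakerFields) (hT : IteratedExpOverSecondExpFields)
    (hL : ExpLogOverExpTowerFields) (hK1 : CurvePointsOverExpLogFields)
    (hG2 : PairBlocksOverCurveClosedFields) :
    ∀ (n : ℕ) (x : Fin n → ℂ), n ≤ 3 → LinearIndependent ℚ x →
      (n : Cardinal) ≤ Algebra.trdeg ℚ ↥(adjoin ℚ (Set.range x ∪ Set.range (cexp ∘ x))) :=
  schanuelUpTo_of_schanuelOn_blockClosed (N := 2) (by norm_num) blockStep_pairHullLit_le
    (schanuelOn_pairHull_of_binders hA h3 h5 hT hL hK1 hG2)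

/-- **The six lower binders prove Schanuel's conjecture for every `n ≤ 2`:** `A → P3 → P5 → T → Λ → K₁ → SC_{≤2}`
(`𝓚` is `1`-block-closed: a `1`-block is a curve point). -/
theorem schanuelUpTo_two_of_binders (hA : SchanuelAtBakerPeriods) (h3 : InhomBakerOverBakerFields)
    (h5 : SecondExpOverInhomBakerFields) (hT : IteratedExpOverSecondExpFields)
    (hL : ExpLogOverExpTowerFields) (hK1 : CurvePointsOverExpLogFields) :
    ∀ (n : ℕ) (x : Fin n → ℂ), n ≤ 2 → LinearIndependent ℚ x →
      (n : Cardinal) ≤ Algebra.trdeg ℚ ↥(adjoin ℚ (Set.range x ∪ Set.range (cexp ∘ x))) :=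
  schanuelUpTo_of_schanuelOn_blockClosed (N := 1) le_rfl blockStep_curveHullLit_le
    (schanuelOn_curveHull_of_binders hA h3 h5 hT hL hK1)

/-- **1J's six lower binders `≽ SchanuelTwo`** (stmt-Schanuel-0069, the `n = 2` item of routes `RootDecomp1`,
`EclCore`, `RoyCriterion` — its text restated literally, not imported): `A → P3 → P5 → T → Λ → K₁ → SchanuelTwo`. -/
theorem schanuelTwo_of_binders (hA : SchanuelAtBakerPeriods) (h3 : InhomBakerOverBakerFields)
    (h5 : SecondExpOverInhomBakerFields) (hT : IteratedExpOverSecondExpFields)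
    (hL : ExpLogOverExpTowerFields) (hK1 : CurvePointsOverExpLogFields) :
    ∀ (x : Fin 2 → ℂ), LinearIndependent ℚ x → (2 : Cardinal) ≤
      Algebra.trdeg ℚ ↥(IntermediateField.adjoin ℚ (Set.range x ∪ Set.range (Complex.exp ∘ x))) :=
  fun x hx => by
  have h2 := schanuelUpTo_two_of_binders hA h3 h5 hT hL hK1 2 x le_rfl hx
  exact_mod_cast h2

/-- **The seven lower binders confine every counterexample at clearance `4` from `𝓚₂`:**
`x̄` free, `trdeg ℚ(x̄, e^{x̄}) < |x̄|` `⇒ dim_ℚ(span x̄ ∩ 𝓚₂) + 4 ≤ |x̄|`. -/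
theorem clearance_four_of_binders (hA : SchanuelAtBakerPeriods) (h3 : InhomBakerOverBakerFields)
    (h5 : SecondExpOverInhomBakerFields) (hT : IteratedExpOverSecondExpFields)
    (hL : ExpLogOverExpTowerFields) (hK1 : CurvePointsOverExpLogFields)
    (hG2 : PairBlocksOverCurveClosedFields) {n : ℕ} {x : Fin n → ℂ} (hx : LinearIndependent ℚ x)
    (hdef : Algebra.trdeg ℚ ↥(adjoin ℚ (Set.range x ∪ Set.range (cexp ∘ x))) < (n : Cardinal)) :
    Module.finrank ℚ ↥(Submodule.span ℚ (Set.range x) ⊓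
      (⨆ n : ℕ, (fun E : Submodule ℚ ℂ => E ⊔ Submodule.span ℚ {x : ℂ | ∃ N : ℕ, N ≤ 2 ∧ ∃ w : Fin N → ℂ, (∃ Y : Finset ℂ, (↑Y : Set ℂ) ⊆ ↑E ∧ ∀ T : Finset ℂ, Y ⊆ T → ∀ (r : ℕ) (ρ : Fin r → Fin N), (∀ j, w j ∈ Submodule.span ℚ ((↑T : Set ℂ) ∪ Set.range (w ∘ ρ))) → Algebra.trdeg ↥(IntermediateField.adjoin ℚ ((↑T : Set ℂ) ∪ Complex.exp '' ↑T)) ↥(IntermediateField.adjoin ↥(IntermediateField.adjoin ℚ ((↑T : Set ℂ) ∪ Complex.exp '' ↑T)) (Set.range w ∪ Set.range (Complex.exp ∘ w))) ≤ r) ∧ x ∈ Set.range w})^[n + 1] (⨆ n : ℕ, (fun E : Submodule ℚ ℂ => E ⊔ Submodule.span ℚ {g : ℂ | ∃ Y : Finset ℂ, (↑Y : Set ℂ) ⊆ ↑E ∧ Algebra.trdeg ↥(IntermediateField.adjoin ℚ ((↑Y : Set ℂ) ∪ Complex.exp '' ↑Y)) ↥(IntermediateField.adjoin ↥(IntermediateField.adjoin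 ℚ ((↑Y : Set ℂ) ∪ Complex.exp '' ↑Y)) ({g, Complex.exp g} : Set ℂ)) ≤ 1})^[n + 1] (⨆ n : ℕ, (fun E : Submodule ℚ ℂ => (E ⊔ Submodule.span ℚ (Complex.exp '' ↑E)) ⊔ Submodule.span ℚ (Complex.exp ⁻¹' ↑(E ⊔ Submodule.span ℚ (Complex.exp '' ↑E))))^[n + 1] (Submodule.span ℚ ({z : ℂ | IsAlgebraic ℚ z} ∪ {z : ℂ | ∃ β l : ℂ, IsAlgebraic ℚ β ∧ IsAlgebraic ℚ (Complex.exp l) ∧ z = β * l})))))) + 4 ≤ n :=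
  clearance_of_schanuelOn_blockClosed (N := 2) (by norm_num) blockStep_pairHullLit_le
    (schanuelOn_pairHull_of_binders hA h3 h5 hT hL hK1 hG2) hx hdef

/-- Under the seven lower binders every `ℚ`-free exp-`3`-cycle is algebraically free. -/
theorem threeCycle_of_binders (hA : SchanuelAtBakerPeriods) (h3 : InhomBakerOverBakerFields)
    (h5 : SecondExpOverInhomBakerFields) (hT : IteratedExpOverSecondExpFields)
    (hL : ExpLogOverExpTowerFields) (hK1 : CurvePointsOverExpLogFields)
    (hG2 : PairBlocksOverCurveClosedFields) {a b c : ℂ} (hab : cexp a = b) (hbc : cexp b = c)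
    (hca : cexp c = a) (hli : LinearIndependent ℚ ![a, b, c]) :
    (3 : Cardinal) ≤ Algebra.trdeg ℚ ↥(adjoin ℚ ({a, b, c} : Set ℂ)) := by
  have h3 := schanuelUpTo_three_of_binders hA h3 h5 hT hL hK1 hG2 3 ![a, b, c] le_rfl hli
  have hsub : Set.range ![a, b, c] ∪ Set.range (cexp ∘ ![a, b, c]) ⊆ ({a, b, c} : Set ℂ) := by
    rintro x (⟨i, rfl⟩ | ⟨i, rfl⟩) <;> fin_cases i <;> simp [hab, hbc, hca]
  exact_mod_cast h3.trans (trdeg_mono (adjoin.mono _ _ _ hsub))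

/-! ### §4 Over the item name -/

/-- **`K₃ ↔ K₃[m ≥ 4]` for the ITEM ITSELF:** `SchanuelOverPairClosedFields` (stmt-Schanuel-30523, as declared
in `Theses/RootDecomp1J.lean`) is equivalent to its own text with `4 ≤ m →` inserted; its layer `m ≤ 3` is the
theorem `RootDecomp1JRankKernel.pairHull_rank_le_three_lit`. -/
theorem schanuelOverPairClosedFields_iff_rank_ge_four : SchanuelOverPairClosedFields ↔
    (∀ (k m : ℕ) (y : Fin k → ℂ) (z : Fin m → ℂ), 4 ≤ m → (∀ i, y i ∈ (⨆ n : ℕ, (fun E : Submodule ℚ ℂ => E ⊔ Submodule.span ℚ {x : ℂ | ∃ N : ℕ, N ≤ 2 ∧ ∃ w : Fin N → ℂ, (∃ Y : Finset ℂ, (↑Y : Set ℂ) ⊆ ↑E ∧ ∀ T : Finset ℂ, Y ⊆ T → ∀ (r : ℕ) (ρ : Fin r → Fin N), (∀ j, w j ∈ Submodule.span ℚ ((↑T : Set ℂ) ∪ Set.range (w ∘ ρ))) → Algebra.trdeg ↥(IntermediateField.adjoin ℚ ((↑T : Set ℂ) ∪ Complex.exp '' ↑T)) ↥(IntermediateField.adjoin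 ↥(IntermediateField.adjoin ℚ ((↑T : Set ℂ) ∪ Complex.exp '' ↑T)) (Set.range w ∪ Set.range (Complex.exp ∘ w))) ≤ r) ∧ x ∈ Set.range w})^[n + 1] (⨆ n : ℕ, (fun E : Submodule ℚ ℂ => E ⊔ Submodule.span ℚ {g : ℂ | ∃ Y : Finset ℂ, (↑Y : Set ℂ) ⊆ ↑E ∧ Algebra.trdeg ↥(IntermediateField.adjoin ℚ ((↑Y : Set ℂ) ∪ Complex.exp '' ↑Y)) ↥(IntermediateField.adjoin ↥(IntermediateField.adjoin ℚ ((↑Y : Set ℂ) ∪ Complex.exp '' ↑Y)) ({g, Complex.exp g} : Set ℂ)) ≤ 1})^[n + 1] (⨆ n : ℕ, (fun E : Submodule ℚ ℂ => (E ⊔ Submodule.span ℚ (Complex.exp '' ↑E)) ⊔ Submodule.span ℚ (Complex.exp ⁻¹' ↑(E ⊔ Submodule.span ℚ (Complex.exp '' ↑E))))^[n + 1] (Submodule.span ℚ ({z : ℂ | IsAlgebraic ℚ z} ∪ {z : ℂ | ∃ β l : ℂ, IsAlgebraic ℚ β ∧ IsAlgebraic ℚ (Complex.exp l) ∧ z =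 β * l})))))) → LinearIndependent ℚ ((⨆ n : ℕ, (fun E : Submodule ℚ ℂ => E ⊔ Submodule.span ℚ {x : ℂ | ∃ N : ℕ, N ≤ 2 ∧ ∃ w : Fin N → ℂ, (∃ Y : Finset ℂ, (↑Y : Set ℂ) ⊆ ↑E ∧ ∀ T : Finset ℂ, Y ⊆ T → ∀ (r : ℕ) (ρ : Fin r → Fin N), (∀ j, w j ∈ Submodule.span ℚ ((↑T : Set ℂ) ∪ Set.range (w ∘ ρ))) → Algebra.trdeg ↥(IntermediateField.adjoin ℚ ((↑T : Set ℂ) ∪ Complex.exp '' ↑T)) ↥(IntermediateField.adjoin ↥(IntermediateField.adjoin ℚ ((↑T : Set ℂ) ∪ Complex.exp '' ↑T)) (Set.range w ∪ Set.range (Complex.exp ∘ w))) ≤ r) ∧ x ∈ Set.range w})^[n + 1] (⨆ n : ℕ, (fun E : Submodule ℚ ℂ => E ⊔ Submodule.span ℚ {g : ℂ | ∃ Y : Finset ℂ, (↑Y : Set ℂ) ⊆ ↑E ∧ Algebra.trdeg ↥(IntermediateField.adjoin ℚ ((↑Y : Set ℂ) ∪ Complex.exp '' ↑Y)) ↥(IntermediateField.adjoin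 ↥(IntermediateField.adjoin ℚ ((↑Y : Set ℂ) ∪ Complex.exp '' ↑Y)) ({g, Complex.exp g} : Set ℂ)) ≤ 1})^[n + 1] (⨆ n : ℕ, (fun E : Submodule ℚ ℂ => (E ⊔ Submodule.span ℚ (Complex.exp '' ↑E)) ⊔ Submodule.span ℚ (Complex.exp ⁻¹' ↑(E ⊔ Submodule.span ℚ (Complex.exp '' ↑E))))^[n + 1] (Submodule.span ℚ ({z : ℂ | IsAlgebraic ℚ z} ∪ {z : ℂ | ∃ β l : ℂ, IsAlgebraic ℚ β ∧ IsAlgebraic ℚ (Complex.exp l) ∧ z = β * l}))))).mkQ ∘ z) → (m : Cardinal) ≤ Algebra.trdeg ↥(IntermediateField.adjoin ℚ (Set.range y ∪ Set.range (Complex.exp ∘ y))) ↥(IntermediateField.adjoin ↥(IntermediateField.adjoin ℚ (Set.range y ∪ Set.range (Complex.exp ∘ y))) (Set.range z ∪ Set.range (Complex.exp ∘ z)))) :=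
  pK3_iff_rank_ge_four_lit

end Summit.Schanuel.Schanuel.Theorems.RootDecomp1JBinderKernel

end
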